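import Summits.ResolutionOfSingularities.ResolutionOfSingularities.Theorems.HilbertStallCert
import Summits.ResolutionOfSingularities.ResolutionOfSingularities.Theorems.HilbertStallDescent
import Summits.ResolutionOfSingularities.ResolutionOfSingularities.Theorems.UltraWalkLaw
import Mathlib.FieldTheory.IsAlgClosed.AlgebraicClosure
import HarnessLib

/-!
# HilbertStall — the certified TRANSLATION of the door `BoundedIsolation` and the split beneath it

Node «HilbertStall» (decomp-res lens-3, g31).  DOOR (tree, verbatim, `Theorems/UltraWalkLaw.lean`):
`UltraWalk.BoundedIsolation` — isolation certificates of size bounded in `(q, D)` uniformly in the field.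

* ONE EQUIV (E3): `boundedIsolation_iff_uniformStall : BoundedIsolation ↔ UniformStall`, where
  `UniformStall` asks for a bound on the Hilbert–Samuel STALL INDEX of the top ideal, uniform in `(q, D)` and the field
  ((→) pigeonhole `stall_of_isolatedTopCert`, (←) the effective determinant trick `isolatedTopCert_of_stall`).
* DECIDED beneath it (E1, slice `HilbertStallCert`): every stall level is a sub-class of the door on which the bound holds
  with the explicit size `stallSize σ L D = μ_L · D + L`; the levels are nested (`stall_mono_index`) and exhaust the
  isolated tops (`isolatedTop_iff_exists_stall`).
* SPLIT of the residual `UniformStall` (E5): `uniformStall_of_genericTriple_localBezout : GenericTriple → LocalBezout₃ →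
  UniformStall` with the explicit level `L = D ^ 3` — base change to `AlgebraicClosure K` (`isolatedTop_map`), a generic
  system of parameters in the span of the Hasse derivatives (P1, WEAKER), refined Bézout for three hypersurfaces
  (P2, the printed port, Fulton1998 Thm. 12.3), monotonicity in the ideal, and DESCENT (`stall_descent`, E4, proved).
* Corollaries BY NAME through g30's kernels: `BoundedIsolation`, `UniformWalks.CompactnessPort`,
  `∀ d, ∃ B, UnifBound d B`, and item 33493's statement `∀ d, ∃ B, UnifFin d B`.
-/

set_option linter.dupNamespace false

noncomputable section

open MvPolynomial
open Literature.AlgebraicGeometry.Resolution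
open Summit.ResolutionOfSingularities.ResolutionOfSingularities.Theorems.TightDefectClasses
open Summit.ResolutionOfSingularities.ResolutionOfSingularities.Theorems.UniformWalks (UnifBound UnifFin CompactnessPort)
open Summit.ResolutionOfSingularities.ResolutionOfSingularities.Theorems.UltraWalk

namespace Summit.ResolutionOfSingularities.ResolutionOfSingularities.Theorems.HilbertStall

/-! ## §1 The translated residual and the EQUIV -/

/-- **THE TRANSLATED RESIDUAL `UniformStall`** — the Hilbert–Samuel stall index of the top ideal of an isolated top of
degree `≤ D` in three variables is bounded by some `L(q, D)`, uniformly in the field: `𝔪^L ≤ J_F + 𝔪^(L+1)`, a finite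
`K`-linear rank condition in degree `≤ L`.  TYPED, NOT PROVED here; equivalent to the door `BoundedIsolation`
(`boundedIsolation_iff_uniformStall`) and reduced below to `GenericTriple ∧ LocalBezout₃` with `L = D ^ 3`. [new]
(Sources: Matsumura1987, §14 (Hilbert–Samuel function, systems of parameters); AtiyahMacdonald1969, Prop. 2.4, Ch. 11;
vandenDriesSchmidt1984, §1.) -/
def UniformStall : Prop :=
  ∀ q D : ℕ, ∃ L : ℕ, ∀ (K : Type) [Field K] (F : MvPolynomial (Fin 3) K),
    F.totalDegree ≤ D → IsolatedTop q F → Stall q F L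

section Field

variable {σ : Type} [DecidableEq σ] [Fintype σ] [Nonempty σ] {K : Type} [Field K]

/-- The stall levels EXHAUST the isolated tops: `IsolatedTop q F ↔ ∃ k, Stall q F k` (→ pigeonhole on a certificate,
← the effective determinant trick). [folklore] -/
theorem isolatedTop_iff_exists_stall {q : ℕ} {F : MvPolynomial σ K} : IsolatedTop q F ↔ ∃ k, Stall q F k :=
  ⟨exists_stall_of_isolatedTop, fun ⟨_, hk⟩ => isolatedTop_of_cert (isolatedTopCert_of_stall le_rfl hk)⟩

end Field

/-- **THE EQUIV (E3): `BoundedIsolation ↔ UniformStall`.**  (→) a certificate of size `β` forces a stall at `3β`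
(`stall_of_isolatedTopCert`); (←) a stall at `L` yields a certificate of size `stallSize (Fin 3) L D` over every field
(`isolatedTopCert_of_stall`). [folklore] -/
theorem boundedIsolation_iff_uniformStall : BoundedIsolation ↔ UniformStall := by
  refine ⟨fun h q D => ?_, fun h q D => ?_⟩
  · obtain ⟨β, hβ⟩ := h q D
    exact ⟨Fintype.card (Fin 3) * β, fun K _ F hF hiso => stall_of_isolatedTopCert (hβ K F hF hiso)⟩
  · obtain ⟨L, hL⟩ := h q D
    exact ⟨stallSize (Fin 3) L D, fun K _ F hF hiso => isolatedTopCert_of_stall hF (hL K F hF hiso)⟩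

/-- One direction unbundled: a uniform stall bound gives the door with the explicit size. [folklore] -/
theorem boundedIsolation_of_uniformStall (h : UniformStall) : BoundedIsolation :=
  boundedIsolation_iff_uniformStall.mpr h

/-! ## §2 The two pieces beneath `UniformStall` -/

/-- **P1 `GenericTriple` (WEAKER · ATTACKABLE)** — over an algebraically closed field, if the origin is an isolated point
of the top locus `V(J_F)` (certificate sense), then THREE elements `g₀, g₁, g₂` of the `K`-span of the generating Hasse
derivatives `D^{(a)}F` (`0 < |a| < q`) already isolate it: `IdealIsolated (g₀, g₁, g₂)`.  A theorem of dimension theory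
(a system of parameters of the `𝔪`-primary ideal `J_F·K[x]_𝔪` chosen generically in the span — Krull's height theorem
plus prime avoidance; an infinite field suffices); it bounds nothing and cannot give `UniformStall` alone.  TYPED, NOT
PROVED here. [new]
(Sources: Matsumura1987, Thm. 14.14; BrunsHerzog1998, Prop. 1.5.12.) -/
def GenericTriple : Prop :=
  ∀ (K : Type) [Field K] [IsAlgClosed K] (q : ℕ) (F : MvPolynomial (Fin 3) K), IsolatedTop q F →
    ∃ g : Fin 3 → MvPolynomial (Fin 3) K,
      (∀ j, g j ∈ Submodule.span K (Set.range fun a : ↥(hasseIndex (Fin 3) q) => hasseDeriv K (a : Fin 3 →₀ ℕ) F)) ∧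
      IdealIsolated (Ideal.span (Set.range g))

/-- **P2 `LocalBezout₃` (COSTUME · KNOWN-MOD-PORT · INSTRUMENTABLE)** — the PRINTED PORT: three polynomials
`g₀, g₁, g₂ ∈ K[x₀, x₁, x₂]` of degree `≤ D` over an algebraically closed field whose common zero locus has the origin as
an isolated point (certificate sense) generate an ideal whose Hilbert–Samuel function at the origin STALLS by index
`D³`.  Derivation from print: the intersection is proper at the origin, the local ring is Cohen–Macaulay, so the
intersection multiplicity `i(0; g₀·g₁·g₂)` equals the length `ℓ = ℓ(𝒪_{𝔸³,0}/(g))` (Fulton1998 Prop. 7.1 (b),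
Ex. 7.1.10) and the refined Bézout theorem (Fulton1998 Thm. 12.3, Ex. 12.3.7 (iii); other components arbitrary) gives
`ℓ ≤ deg g₀ · deg g₁ · deg g₂ ≤ D³`; the stall index is `≤ ℓ` (the Hilbert–Samuel function increases strictly until it
stalls) and `s · 𝔪^ℓ ⊆ (g)` with `s(0) = 1` gives `x^b = s x^b − (s − 1) x^b ∈ (g) + 𝔪^(ℓ+1)` for `|b| = ℓ`, i.e.
`IdealStall (g) ℓ`, whence `IdealStall (g) (D³)` by upward closure.  TYPED, NOT PROVED here (intersection multiplicity
is not in Mathlib). [new]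
(Sources: Fulton1998, Thm. 12.3, Ex. 12.3.7 (iii), Prop. 7.1 (b), Ex. 7.1.10; vandenDriesSchmidt1984, §1.) -/
def LocalBezout₃ : Prop :=
  ∀ (K : Type) [Field K] [IsAlgClosed K] (D : ℕ) (g : Fin 3 → MvPolynomial (Fin 3) K),
    (∀ j, (g j).totalDegree ≤ D) → IdealIsolated (Ideal.span (Set.range g)) →
      IdealStall (Ideal.span (Set.range g)) (D ^ 3)

/-! ## §3 The kernel beneath the residual: `GenericTriple → LocalBezout₃ → UniformStall` with `L = D³` -/

section Span

variable {σ : Type} [DecidableEq σ] [Fintype σ] {K : Type} [Field K]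

/-- Elements of the `K`-span of the generating Hasse derivatives of `F` have degree `≤ deg F`. [folklore] -/
theorem totalDegree_le_of_mem_span {q D : ℕ} {F : MvPolynomial σ K} (hF : F.totalDegree ≤ D) {g : MvPolynomial σ K}
    (hg : g ∈ Submodule.span K (Set.range fun a : ↥(hasseIndex σ q) => hasseDeriv K (a : σ →₀ ℕ) F)) :
    g.totalDegree ≤ D := by
  obtain ⟨c, hc⟩ := (Submodule.mem_span_range_iff_exists_fun K).mp hg
  rw [← hc]
  exact totalDegree_finsetSum_le fun a _ =>
    (totalDegree_smul_le _ _).trans (totalDegree_hasseDeriv_le_of_le hF)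

/-- The `K`-span of the generating Hasse derivatives lies in the top ideal. [folklore] -/
theorem mem_topIdeal_of_mem_span {q : ℕ} {F : MvPolynomial σ K} {g : MvPolynomial σ K}
    (hg : g ∈ Submodule.span K (Set.range fun a : ↥(hasseIndex σ q) => hasseDeriv K (a : σ →₀ ℕ) F)) :
    g ∈ topIdeal q F := by
  obtain ⟨c, hc⟩ := (Submodule.mem_span_range_iff_exists_fun K).mp hg
  rw [← hc]
  refine Ideal.sum_mem _ fun a _ => ?_
  rw [smul_eq_C_mul]
  exact Ideal.mul_mem_left _ _ (Ideal.subset_span ⟨(a : σ →₀ ℕ), mem_hasseIndex.mp a.2, rfl⟩)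

end Span

/-- **THE KERNEL BENEATH THE RESIDUAL (E5).**  `GenericTriple → LocalBezout₃ → UniformStall`, with the explicit level
`L = D ^ 3`: base change to `AlgebraicClosure K` (isolation and degree ascend), pick the generic triple in the span of
the Hasse derivatives (degrees `≤ D`, inside the top ideal), apply the printed port, enlarge the ideal
(`idealStall_mono`), and DESCEND the stall to `K` (`stall_descent`). [folklore] -/
theorem uniformStall_of_genericTriple_localBezout (h₁ : GenericTriple) (h₂ : LocalBezout₃) : UniformStall := by
  intro q D
  refine ⟨D ^ 3, fun K _ F hF hiso => ?_⟩
  let K' := AlgebraicClosure K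
  refine stall_descent (K' := K') ?_
  have hF' : (map (algebraMap K K') F).totalDegree ≤ D := totalDegree_map_le_of_le _ hF
  have hiso' : IsolatedTop q (map (algebraMap K K') F) := isolatedTop_map _ hiso
  obtain ⟨g, hg, hgiso⟩ := h₁ K' q (map (algebraMap K K') F) hiso'
  have hdeg : ∀ j, (g j).totalDegree ≤ D := fun j => totalDegree_le_of_mem_span hF' (hg j)
  have hle : Ideal.span (Set.range g) ≤ topIdeal q (map (algebraMap K K') F) :=
    Ideal.span_le.mpr (Set.range_subset_iff.mpr fun j => mem_topIdeal_of_mem_span (hg j))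
  exact idealStall_mono hle (h₂ K' D g hdeg hgiso)

/-- The explicit level: under the two pieces every isolated top of degree `≤ D` stalls at `D³`, over every field.
[folklore] -/
theorem stall_cube_of_genericTriple_localBezout (h₁ : GenericTriple) (h₂ : LocalBezout₃) {q D : ℕ} (K : Type) [Field K]
    (F : MvPolynomial (Fin 3) K) (hF : F.totalDegree ≤ D) (hiso : IsolatedTop q F) : Stall q F (D ^ 3) := by
  let K' := AlgebraicClosure K
  refine stall_descent (K' := K') ?_
  obtain ⟨g, hg, hgiso⟩ := h₁ K' q (map (algebraMap K K') F) (isolatedTop_map _ hiso)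
  exact idealStall_mono (Ideal.span_le.mpr (Set.range_subset_iff.mpr fun j => mem_topIdeal_of_mem_span (hg j)))
    (h₂ K' D g (fun j => totalDegree_le_of_mem_span (totalDegree_map_le_of_le _ hF) (hg j)) hgiso)

/-! ## §4 Corollaries BY NAME through the g30 kernels -/

/-- The two pieces give the door `BoundedIsolation`, with `β = stallSize (Fin 3) (D³) D`. [folklore] -/
theorem boundedIsolation_of_genericTriple_localBezout (h₁ : GenericTriple) (h₂ : LocalBezout₃) : BoundedIsolation :=
  boundedIsolation_of_uniformStall (uniformStall_of_genericTriple_localBezout h₁ h₂)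

/-- The two pieces give the certificate with the EXPLICIT size `stallSize (Fin 3) (D ^ 3) D`. [folklore] -/
theorem isolatedTopCert_of_genericTriple_localBezout (h₁ : GenericTriple) (h₂ : LocalBezout₃) {q D : ℕ} (K : Type)
    [Field K] (F : MvPolynomial (Fin 3) K) (hF : F.totalDegree ≤ D) (hiso : IsolatedTop q F) :
    IsolatedTopCert q (stallSize (Fin 3) (D ^ 3) D) F :=
  isolatedTopCert_of_stall hF (stall_cube_of_genericTriple_localBezout h₁ h₂ K F hF hiso)

/-- The two pieces give `UniformWalks.CompactnessPort` (g30 kernel `compactnessPort_of_boundedIsolation`). [folklore] -/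
theorem compactnessPort_of_genericTriple_localBezout (h₁ : GenericTriple) (h₂ : LocalBezout₃) : CompactnessPort :=
  compactnessPort_of_boundedIsolation (boundedIsolation_of_genericTriple_localBezout h₁ h₂)

/-- The two pieces give the uniform run bound `∀ d, ∃ B, UnifBound d B` (g30 kernel). [folklore] -/
theorem unifBound_exists_of_genericTriple_localBezout (h₁ : GenericTriple) (h₂ : LocalBezout₃) (d : ℕ) :
    ∃ B, UnifBound d B :=
  unifBound_exists_of_boundedIsolation (boundedIsolation_of_genericTriple_localBezout h₁ h₂) d

/-- The two pieces give item 33493's statement `∀ d, ∃ B, UnifFin d B` (g30 kernel). [folklore] -/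
theorem unifFin_exists_of_genericTriple_localBezout (h₁ : GenericTriple) (h₂ : LocalBezout₃) :
    ∀ d : ℕ, ∃ B : ℕ, UnifFin d B :=
  unifFin_exists_of_boundedIsolation (boundedIsolation_of_genericTriple_localBezout h₁ h₂)

/-- The translated residual alone already gives the port and item 33493's statement. [folklore] -/
theorem unifFin_exists_of_uniformStall (h : UniformStall) : ∀ d : ℕ, ∃ B : ℕ, UnifFin d B :=
  unifFin_exists_of_boundedIsolation (boundedIsolation_of_uniformStall h)

end Summit.ResolutionOfSingularities.ResolutionOfSingularities.Theorems.HilbertStall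

end
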